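import Summits.ResolutionOfSingularities.ResolutionOfSingularities.Theorems.PurelyInseparableDim4ResConePowerChain
import Summits.ResolutionOfSingularities.ResolutionOfSingularities.Theorems.PurelyInseparableDim4ResConeSatellitePair
import HarnessLib
import HarnessLib.Audit.Tags

/-!
# Purely inseparable four-folds — POWER CONES, THE L-SECTOR: if no free letter ever carries the linear form, the form FREEZES on a
# PERMANENT set of ONE OR TWO boundary letters (every prime, every shade; K2(p) lane, B rows = power cones `e_G = 3`; seat res-dim4-p-1 g6)

[OURS · counted 0 · cell `res-dim4-pi` · K2(p) lane (holder res-dim4-p-12 g5, rulings g5-13: B-LF roster; (iv) T-sector re-presentation = p-1).]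
Nothing here proves any TAIL(p, d, 3), K2(p), `NoIsolatedTrap p p`, the Cossart–Jannsen–Saito / Cossart–Piltant theorems or resolution of
singularities in dimension ≥ 4 / characteristic `p` — NOT proved; a STRUCTURE statement about OUR frame's hypothetical `Step0 p` chains.
AI kernel work, weaker than expert review.

SETTING.  A witnessed isolated above-floor `Step0 p` chain with `x^{r₀} ∣ F₀`, constant shade `d < p` and POWER residual cone from `k₀`:
`chain_powerCone_package` (p-9/holder lineage, `…ResConePowerChain`) gives linear forms `ℓ k ≠ 0` with `Vtx_k = ker ℓ k`, the DIRECTION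
EQUATION `ℓ k (j k) + ℓ k ⬝ᵥ b k = 0` and the PROPAGATION `ℓ (k+1) i = λ k · ℓ k i` (`i ≠ j k`, `λ k ≠ 0`).  These three laws are taken as
hypotheses here (so the file is pure bookkeeping over them).  The T-SECTOR is «at some late time a FREE letter `φ` (`r φ = 0`) carries the form
(`ℓ φ ≠ 0`)» — there `…ResConeSupportConfinedRank`'s `powerCone_freeCarrier_representation` re-presents the tail with `φ` passive for ever.
THIS FILE treats the complement, the **L-SECTOR** «from `k₁` on, every free letter is killed by the form»
(`hL : ∀ k ≥ k₁, ∀ i, r_k i = 0 → ℓ k i = 0`):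
* §1 `apply_eq_zero_of_translated_of_L` — a TRANSLATED letter does not carry the form (it is free at `k + 1`, so `ℓ (k+1) i = 0 = λ·ℓ k i`);
  `apply_chart_eq_zero_of_L` — hence the direction equation kills the CHART letter too: `ℓ k (j k) = 0`; `apply_ne_zero_succ_of_L` /
  `apply_ne_zero_of_le_of_L` — so the SUPPORT of the form only GROWS (propagation off the chart).
* §2 **`exists_frozen_formSupport_of_L`** — the support is eventually a CONSTANT set `N` with `1 ≤ #N ≤ 2`, and every letter of `N` is
  PERMANENT from then on (weight `≥ 1`, never charted, never translated): **in the L-sector the power cone is a FROZEN form in one or two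
  permanent boundary letters, all charts and translations living on the other letters** (`#N ≤ 2` because the charts avoid `N` and a single
  available chart letter would make every late step free — FT `exists_satellite_ge`).  `#N = 1` is the «tangent» shape `g = a·x_z^d`
  (the residual cone is the `d`-th power of ONE BOUNDARY variable); `#N = 2` a binomial form in two frozen boundary letters.
* §3 `powerCone_TL_dichotomy` — pure logic: either the L-sector holds from some `k₁ ≥ k₀`, or T-entries (`r_k φ = 0 ∧ ℓ k φ ≠ 0`) occur beyond
  every time.
So every power-cone tail is EITHER (T) re-presentable with a passive form-carrying letter (`…SupportConfinedRank`) OR (L) a frozen power form on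
≤ 2 permanent letters dragged by a game on the others — the e_G = 3 counterpart of the e_G = 2 residue «two-letter game × frozen cone monomial».
[cite: CossartJannsenSaito2020, Thm. 3.10(4), Thm. 3.14] [cite: Hauser2010, §§F–G (chart expressions of a point blowup; cleaning)]
[cite: CossartPiltant2009, Ch. 4 Def. I.1 (κ = 5: `H⁻¹Df ≡ u₁^ω`), Thm. I.3]
bears_on: LADDER-RESOLUTION:D157-DOOR2 (res-dim4-pi · K2(p) = `RidgeBudget.NoAboveFloorTrap p p` · B rows · power cones: L-sector form freezes on
≤ 2 permanent letters).  Supports stmt-ResolutionOfSingularities-16155 (helper).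
-/

set_option linter.dupNamespace false -- mandated namespace of this single-conjunct summit

noncomputable section

namespace Summit.ResolutionOfSingularities.ResolutionOfSingularities.Theorems.PIDim4

namespace ResCone

open MvPolynomial Finset
open Literature.AlgebraicGeometry.Resolution
open Literature.AlgebraicGeometry.Resolution.CentreBlowup
open Literature.AlgebraicGeometry.Resolution.Hauser2010
open Literature.AlgebraicGeometry.Resolution.HauserPerlega2019

variable {K : Type} [Field K] [DecidableEq K] (p : ℕ) [Fact p.Prime]

/-! ## §1 In the L-sector the form avoids every translated letter and every chart letter -/

/-- **A TRANSLATED LETTER DOES NOT CARRY THE FORM** (L-sector): if `b k i ≠ 0` then `ℓ k i = 0` — the letter is free at `k + 1`, the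
L-sector kills `ℓ (k+1) i`, and propagation `ℓ (k+1) i = λ·ℓ k i` with `λ ≠ 0` pulls it back. [OURS]
[cite: CossartJannsenSaito2020, Thm. 3.14] [cite: HauserPerlega2019PRIMS, §2 (transform D′ of D)] -/
theorem apply_eq_zero_of_translated_of_L {c : ℕ → State K} {j : ℕ → Fin 4} {b : ℕ → Fin 4 → K}
    (hc : ∀ k, IsIsolated p (c k).F ∧ Step0 p (c k) (c (k + 1))) (hw : FreeTail.IsWitnessedChain p c j b)
    (hfloor : ∀ k, ordZero (c k).F ≠ p) {k₀ : ℕ} {ℓ : ℕ → Fin 4 → K} {lam : ℕ → K}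
    (hlam : ∀ k, k₀ ≤ k → lam k ≠ 0) (hprop : ∀ k, k₀ ≤ k → ∀ i, i ≠ j k → ℓ (k + 1) i = lam k * ℓ k i)
    {k₁ : ℕ} (hk₁ : k₀ ≤ k₁) (hL : ∀ k, k₁ ≤ k → ∀ i, (c k).r i = 0 → ℓ k i = 0)
    {k : ℕ} (hk : k₁ ≤ k) {i : Fin 4} (hbi : b k i ≠ 0) : ℓ k i = 0 := by
  have hij : i ≠ j k := fun h => hbi (by rw [h]; exact (hw k).2.1)
  obtain ⟨o, ho, -, -⟩ := chain_band p hc hfloor k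
  have hr0 : (c (k + 1)).r i = 0 := by
    rw [(hw k).2.2.2.2, step_r_univ' p (j k) (b k) (c k) ho, Finsupp.coe_update, Function.update_of_ne hij,
      Finsupp.filter_apply, if_neg hbi]
  have h := hL (k + 1) (by omega) i hr0
  rw [hprop k (by omega) i hij] at h
  exact (mul_eq_zero.mp h).resolve_left (hlam k (by omega))

/-- **THE CHART LETTER DOES NOT CARRY THE FORM** (L-sector): `ℓ k (j k) = 0` — the direction equation `ℓ k (j k) + ℓ k ⬝ᵥ b k = 0` with every
translated letter killed by `apply_eq_zero_of_translated_of_L`. [OURS] [cite: CossartJannsenSaito2020, Thm. 3.14] -/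
theorem apply_chart_eq_zero_of_L {c : ℕ → State K} {j : ℕ → Fin 4} {b : ℕ → Fin 4 → K}
    (hc : ∀ k, IsIsolated p (c k).F ∧ Step0 p (c k) (c (k + 1))) (hw : FreeTail.IsWitnessedChain p c j b)
    (hfloor : ∀ k, ordZero (c k).F ≠ p) {k₀ : ℕ} {ℓ : ℕ → Fin 4 → K} {lam : ℕ → K}
    (hdir : ∀ k, k₀ ≤ k → ℓ k (j k) + dotProduct (ℓ k) (b k) = 0)
    (hlam : ∀ k, k₀ ≤ k → lam k ≠ 0) (hprop : ∀ k, k₀ ≤ k → ∀ i, i ≠ j k → ℓ (k + 1) i = lam k * ℓ k i)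
    {k₁ : ℕ} (hk₁ : k₀ ≤ k₁) (hL : ∀ k, k₁ ≤ k → ∀ i, (c k).r i = 0 → ℓ k i = 0)
    {k : ℕ} (hk : k₁ ≤ k) : ℓ k (j k) = 0 := by
  have hdot : dotProduct (ℓ k) (b k) = 0 := by
    refine Finset.sum_eq_zero fun i _ => ?_
    by_cases hbi : b k i = 0
    · rw [hbi, mul_zero]
    · rw [apply_eq_zero_of_translated_of_L p hc hw hfloor hlam hprop hk₁ hL hk hbi, zero_mul]
  have h := hdir k (by omega)
  rwa [hdot, add_zero] at h

/-- **THE SUPPORT OF THE FORM ONLY GROWS** (L-sector): `ℓ k i ≠ 0 ⇒ ℓ (k+1) i ≠ 0`. [OURS] [cite: CossartJannsenSaito2020, Thm. 3.14] -/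
theorem apply_ne_zero_succ_of_L {c : ℕ → State K} {j : ℕ → Fin 4} {b : ℕ → Fin 4 → K}
    (hc : ∀ k, IsIsolated p (c k).F ∧ Step0 p (c k) (c (k + 1))) (hw : FreeTail.IsWitnessedChain p c j b)
    (hfloor : ∀ k, ordZero (c k).F ≠ p) {k₀ : ℕ} {ℓ : ℕ → Fin 4 → K} {lam : ℕ → K}
    (hdir : ∀ k, k₀ ≤ k → ℓ k (j k) + dotProduct (ℓ k) (b k) = 0)
    (hlam : ∀ k, k₀ ≤ k → lam k ≠ 0) (hprop : ∀ k, k₀ ≤ k → ∀ i, i ≠ j k → ℓ (k + 1) i = lam k * ℓ k i)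
    {k₁ : ℕ} (hk₁ : k₀ ≤ k₁) (hL : ∀ k, k₁ ≤ k → ∀ i, (c k).r i = 0 → ℓ k i = 0)
    {k : ℕ} (hk : k₁ ≤ k) {i : Fin 4} (hi : ℓ k i ≠ 0) : ℓ (k + 1) i ≠ 0 := by
  have hij : i ≠ j k := fun h => hi (by rw [h]; exact apply_chart_eq_zero_of_L p hc hw hfloor hdir hlam hprop hk₁ hL hk)
  rw [hprop k (by omega) i hij]
  exact mul_ne_zero (hlam k (by omega)) hi

/-- **THE SUPPORT OF THE FORM ONLY GROWS, along a stretch** (L-sector): `ℓ k i ≠ 0 ⇒ ℓ k′ i ≠ 0` for `k₁ ≤ k ≤ k′`. [OURS]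
[cite: CossartJannsenSaito2020, Thm. 3.14] -/
theorem apply_ne_zero_of_le_of_L {c : ℕ → State K} {j : ℕ → Fin 4} {b : ℕ → Fin 4 → K}
    (hc : ∀ k, IsIsolated p (c k).F ∧ Step0 p (c k) (c (k + 1))) (hw : FreeTail.IsWitnessedChain p c j b)
    (hfloor : ∀ k, ordZero (c k).F ≠ p) {k₀ : ℕ} {ℓ : ℕ → Fin 4 → K} {lam : ℕ → K}
    (hdir : ∀ k, k₀ ≤ k → ℓ k (j k) + dotProduct (ℓ k) (b k) = 0)
    (hlam : ∀ k, k₀ ≤ k → lam k ≠ 0) (hprop : ∀ k, k₀ ≤ k → ∀ i, i ≠ j k → ℓ (k + 1) i = lam k * ℓ k i)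
    {k₁ : ℕ} (hk₁ : k₀ ≤ k₁) (hL : ∀ k, k₁ ≤ k → ∀ i, (c k).r i = 0 → ℓ k i = 0)
    {k k' : ℕ} (hk : k₁ ≤ k) (hkk' : k ≤ k') {i : Fin 4} (hi : ℓ k i ≠ 0) : ℓ k' i ≠ 0 := by
  induction k', hkk' using Nat.le_induction with
  | base => exact hi
  | succ k' hkk' ih => exact apply_ne_zero_succ_of_L p hc hw hfloor hdir hlam hprop hk₁ hL (by omega) ih

/-! ## §2 The form freezes on a permanent set of one or two letters -/

omit [DecidableEq K] [Fact p.Prime] in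
/-- A monotone bounded `ℕ`-sequence is eventually constant (a `private` copy of res-dim4-p-5 g5's `eventually_const_of_mono_bdd`,
`…ThreeLettersSubTwo`, kept local to spare this file that module's import). [folklore] -/
private theorem eventually_const_of_monotone_le (f : ℕ → ℕ) (B : ℕ) (hmono : ∀ n, f n ≤ f (n + 1)) (hbdd : ∀ n, f n ≤ B) :
    ∃ N, ∀ n, N ≤ n → f n = f N := by
  by_contra h
  push Not at h
  have hmono' : Monotone f := monotone_nat_of_le_succ hmono
  have key : ∀ t, ∃ n, t ≤ f n := by
    intro t
    induction t with
    | zero => exact ⟨0, Nat.zero_le _⟩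
    | succ t ih =>
      obtain ⟨n, hn⟩ := ih
      obtain ⟨m, hm, hne⟩ := h n
      have hle : f n ≤ f m := hmono' hm
      exact ⟨m, by omega⟩
  obtain ⟨n, hn⟩ := key (B + 1)
  have := hbdd n
  omega


/-- **IN THE L-SECTOR THE FORM FREEZES ON A PERMANENT SET OF ONE OR TWO BOUNDARY LETTERS** (every prime `p`, every shade; characteristic
`p` only through FT).  Along a witnessed isolated above-floor `Step0 p` chain with constant shade from `k₀` and power-cone data (`ℓ k ≠ 0`,
direction equation, propagation), if from `k₁ ≥ k₀` on every free letter is killed by the form, then from some `k₂ ≥ k₁` on the support of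
`ℓ k` is a CONSTANT set `N`, `1 ≤ #N ≤ 2`, and every letter of `N` has weight `≥ 1`, is never charted and never translated. [OURS]
[cite: CossartJannsenSaito2020, Thm. 3.10(4), Thm. 3.14] [cite: CossartPiltant2009, Ch. 4 Def. I.1, Thm. I.3] -/
theorem exists_frozen_formSupport_of_L [CharP K p] {c : ℕ → State K} {j : ℕ → Fin 4} {b : ℕ → Fin 4 → K}
    (hc : ∀ k, IsIsolated p (c k).F ∧ Step0 p (c k) (c (k + 1))) (hw : FreeTail.IsWitnessedChain p c j b)
    (hfloor : ∀ k, ordZero (c k).F ≠ p) {k₀ : ℕ} {ℓ : ℕ → Fin 4 → K} {lam : ℕ → K}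
    (hℓ0 : ∀ k, k₀ ≤ k → ℓ k ≠ 0) (hdir : ∀ k, k₀ ≤ k → ℓ k (j k) + dotProduct (ℓ k) (b k) = 0)
    (hlam : ∀ k, k₀ ≤ k → lam k ≠ 0) (hprop : ∀ k, k₀ ≤ k → ∀ i, i ≠ j k → ℓ (k + 1) i = lam k * ℓ k i)
    {k₁ : ℕ} (hk₁ : k₀ ≤ k₁) (hL : ∀ k, k₁ ≤ k → ∀ i, (c k).r i = 0 → ℓ k i = 0) :
    ∃ k₂, k₁ ≤ k₂ ∧ ∃ N : Finset (Fin 4), N.Nonempty ∧ N.card ≤ 2 ∧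
      (∀ k, k₂ ≤ k → ∀ i, ℓ k i ≠ 0 ↔ i ∈ N) ∧
      (∀ i ∈ N, ∀ k, k₂ ≤ k → 1 ≤ (c k).r i ∧ j k ≠ i ∧ b k i = 0) := by
  classical
  -- the support sets grow along the L-stretch
  set Sup : ℕ → Finset (Fin 4) := fun n => Finset.univ.filter fun i => ℓ (k₁ + n) i ≠ 0 with hSup
  have hmemSup : ∀ n i, i ∈ Sup n ↔ ℓ (k₁ + n) i ≠ 0 := fun n i => by
    rw [hSup, Finset.mem_filter]; exact ⟨fun h => h.2, fun h => ⟨Finset.mem_univ i, h⟩⟩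
  have hmonoS : ∀ n, Sup n ⊆ Sup (n + 1) := fun n i hi => by
    rw [hmemSup] at hi ⊢
    rw [show k₁ + (n + 1) = k₁ + n + 1 by ring]
    exact apply_ne_zero_succ_of_L p hc hw hfloor hdir hlam hprop hk₁ hL (by omega) hi
  obtain ⟨n₀, hn₀⟩ := eventually_const_of_monotone_le (fun n => (Sup n).card) 4 (fun n => Finset.card_le_card (hmonoS n))
    (fun n => (Finset.card_le_univ _).trans (by rw [Fintype.card_fin]))
  have hmonoS' : ∀ n m, n ≤ m → Sup n ⊆ Sup m := by
    intro n m hnm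
    induction m, hnm using Nat.le_induction with
    | base => exact Finset.Subset.refl _
    | succ m hnm ih => exact ih.trans (hmonoS m)
  have hconst : ∀ n, n₀ ≤ n → Sup n = Sup n₀ := fun n hn =>
    (Finset.eq_of_subset_of_card_le (hmonoS' n₀ n hn) (by rw [hn₀ n hn])).symm
  set N : Finset (Fin 4) := Sup n₀ with hN
  have hmemN : ∀ k, k₁ + n₀ ≤ k → ∀ i, ℓ k i ≠ 0 ↔ i ∈ N := by
    intro k hk i
    obtain ⟨n, rfl⟩ : ∃ n, k = k₁ + n := ⟨k - k₁, by omega⟩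
    rw [← hmemSup n i, hconst n (by omega)]
  refine ⟨k₁ + n₀, by omega, N, ?_, ?_, hmemN, fun i hi k hk => ?_⟩
  · -- non-empty: `ℓ ≠ 0`
    by_contra hempty
    rw [Finset.not_nonempty_iff_eq_empty] at hempty
    apply hℓ0 (k₁ + n₀) (by omega)
    funext i
    by_contra hi
    have h := (hmemN (k₁ + n₀) le_rfl i).mp hi
    rw [hempty] at h
    exact Finset.notMem_empty i h
  · -- at most two letters: the charts avoid `N`, and one available chart letter would freeze the chart
    by_contra h3
    push Not at h3
    have hcompl : (Finset.univ \ N).card ≤ 1 := by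
      rw [Finset.card_sdiff_of_subset (Finset.subset_univ N), Finset.card_univ, Fintype.card_fin]; omega
    have hjout : ∀ k, k₁ + n₀ ≤ k → j k ∈ Finset.univ \ N := fun k hk =>
      Finset.mem_sdiff.mpr ⟨Finset.mem_univ _, fun hj =>
        ((hmemN k hk (j k)).mpr hj) (apply_chart_eq_zero_of_L p hc hw hfloor hdir hlam hprop hk₁ hL (by omega))⟩
    obtain ⟨m, hm, hsat⟩ := exists_satellite_ge p hc hw (k₁ + n₀)
    exact hsat.1 (Finset.card_le_one.mp hcompl _ (hjout (m + 1) (by omega)) _ (hjout m hm))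
  · have hℓi : ℓ k i ≠ 0 := (hmemN k hk i).mpr hi
    refine ⟨?_, fun h => hℓi (by rw [← h]; exact apply_chart_eq_zero_of_L p hc hw hfloor hdir hlam hprop hk₁ hL (by omega)),
      ?_⟩
    · by_contra h0
      exact hℓi (hL k (by omega) i (by omega))
    · by_contra hb
      exact hℓi (apply_eq_zero_of_translated_of_L p hc hw hfloor hlam hprop hk₁ hL (by omega) hb)

/-! ## §3 The T/L dichotomy -/

omit [DecidableEq K] [Fact p.Prime] in
/-- **T OR L** (pure logic): either the L-sector holds from some `k₁ ≥ k₀`, or T-entries — a free letter carrying the form — occur beyond every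
time. [folklore] -/
theorem powerCone_TL_dichotomy {c : ℕ → State K} {ℓ : ℕ → Fin 4 → K} (k₀ : ℕ) :
    (∃ k₁, k₀ ≤ k₁ ∧ ∀ k, k₁ ≤ k → ∀ i, (c k).r i = 0 → ℓ k i = 0) ∨
    (∀ k₁, k₀ ≤ k₁ → ∃ k, k₁ ≤ k ∧ ∃ φ, (c k).r φ = 0 ∧ ℓ k φ ≠ 0) := by
  by_cases h : ∃ k₁, k₀ ≤ k₁ ∧ ∀ k, k₁ ≤ k → ∀ i, (c k).r i = 0 → ℓ k i = 0
  · exact Or.inl h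
  · right
    intro k₁ hk₁
    by_contra hno
    push Not at hno
    exact h ⟨k₁, hk₁, fun k hk i hi => hno k hk i hi⟩

end ResCone

end Summit.ResolutionOfSingularities.ResolutionOfSingularities.Theorems.PIDim4

end
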